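import Mathlib.Tactic.LinearCombination
import Summits.MatrixMultiplication.OmegaCensus.DihedralLawModOneShapeB
import Summits.MatrixMultiplication.OmegaCensus.DihedralLawModOneTwoCosets
import Summits.MatrixMultiplication.OmegaCensus.VertexCountingModOneShape
import Summits.MatrixMultiplication.OmegaCensus.DihedralLikeLawGap
import Summits.MatrixMultiplication.OmegaCensus.DihedralLawModOneSmallExponent
import HarnessLib

/-!
# `|A| ≡ 1 (mod 3)`: every non-cube law shape forces a cyclic subgroup of index ≤ 2; the prime case

ω-census, family (b3).  Framing: lottery ticket; floor = certified bounds/negative ranges.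

Dihedral-like presentation `ρ, τ : A → G` over a finite abelian group `A` with `|A| ≡ 1 (mod 3)`, `|A| ≥ 14`.
By `mod_one_law_shape` a TPP triple attaining the law `3|S||T||U| + 8 = 8|A|` has coset parts forming a cube
`(c,c | d,d | e,e)` or, up to the roles of the three sets and of the two cosets, the shape `(1,1 | 1,1 | q±1,q∓1)`
(`DihedralLawModOneTwoCosets.lean`) or `(c,c+1 | 2,2 | 1,1)` (`DihedralLawModOneShapeB.lean`).  This file supplies
the symmetries (rotation / reversal of the triple, left translation by `τ 0` swapping the two cosets) and
assembles:

* `two_cosets_of_mod_one_law_of_not_cube`: a law-attaining triple whose part sizes are **not** a cube forces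
  `A = (a + ⟨g⟩) ∪ (b + ⟨g⟩)`;
* `two_cosets_of_mod_one_law_prime`: if `|A| = 3p + 1 ≥ 14` with `p` prime, **every** law-attaining triple does
  (a cube would have `cde = p`).  So for these orders (`16, 22, 34, 40, 52, 58, 70, …`) the law `(8|A| − 8)/3` is
  attained only over `A` with a cyclic subgroup of index `≤ 2` — e.g. not over `ℤ₄²`, `ℤ₂² × ℤ₄`, `ℤ₂⁴`,
  `ℤ₂² × ℤ₁₀` (census data `β(Dih(ℤ₄²)) = β(Dih(ℤ₂²×ℤ₄)) = 32`, now theorems for the whole order).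
-/

namespace Summit.MatrixMultiplication.OmegaCensus

open Literature.Combinatorics.Additive Finset

section Symmetries

variable {G : Type*} [Group G] [DecidableEq G] {S T U : Finset G}

omit [DecidableEq G] in
/-- Reversal symmetry of the triple product property: `(S, T, U) ↦ (U, T, S)` (invert the defining relation).
[folklore] -/
theorem tpp_reverse (h : TripleProductProperty S T U) : TripleProductProperty U T S := by
  intro u hu u' hu' t ht t' ht' s hs s' hs' he
  have he' : s' * s⁻¹ * (t' * t⁻¹) * (u' * u⁻¹) = 1 := by
    have := congrArg (·⁻¹) he
    simpa only [mul_inv_rev, inv_inv, inv_one, mul_assoc] using this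
  obtain ⟨h1, h2, h3⟩ := h s' hs' s hs t' ht' t ht u' hu' u hu he'
  exact ⟨h3.symm, h2.symm, h1.symm⟩

omit [DecidableEq G] in
/-- Common left translation preserves the triple product property (the relation is conjugated). [folklore] -/
theorem tpp_map_mulLeft (h : TripleProductProperty S T U) (g : G) :
    TripleProductProperty (S.map (Equiv.mulLeft g).toEmbedding) (T.map (Equiv.mulLeft g).toEmbedding)
      (U.map (Equiv.mulLeft g).toEmbedding) := by
  intro s hs s' hs' t ht t' ht' u hu u' hu' he
  simp only [Finset.mem_map_equiv, Equiv.mulLeft_symm_apply] at hs hs' ht ht' hu hu'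
  have key : g⁻¹ * s * (g⁻¹ * s')⁻¹ * (g⁻¹ * t * (g⁻¹ * t')⁻¹) * (g⁻¹ * u * (g⁻¹ * u')⁻¹) = 1 := by
    rw [show g⁻¹ * s * (g⁻¹ * s')⁻¹ * (g⁻¹ * t * (g⁻¹ * t')⁻¹) * (g⁻¹ * u * (g⁻¹ * u')⁻¹) =
      g⁻¹ * (s * s'⁻¹ * (t * t'⁻¹) * (u * u'⁻¹)) * g by group, he]
    group
  obtain ⟨h1, h2, h3⟩ := h _ hs _ hs' _ ht _ ht' _ hu _ hu' key
  exact ⟨mul_left_cancel h1, mul_left_cancel h2, mul_left_cancel h3⟩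

end Symmetries

section DihedralLike

variable {A : Type*} [AddCommGroup A] [DecidableEq A] [Fintype A] {G : Type} [Group G] [DecidableEq G]
  {ρ τ : A → G} {c₀ : A} {S T U : Finset G}

/-- Left translation by `τ 0` turns the `ρ`-part of `X` into a translate of the `τ`-part. [folklore] -/
theorem card_rho_part_mulLeft_tau (hρρ : ∀ a b, ρ a * ρ b = ρ (a + b)) (hτρ : ∀ a b, τ a * ρ b = τ (a + b))
    (hττ : ∀ a b, τ a * τ b = ρ (c₀ + b - a)) (X : Finset G) :
    (univ.filter fun a : A => ρ a ∈ X.map (Equiv.mulLeft (τ 0)).toEmbedding).card =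
      (univ.filter fun a : A => τ a ∈ X).card := by
  have hset : (univ.filter fun a : A => ρ a ∈ X.map (Equiv.mulLeft (τ 0)).toEmbedding) =
      (univ.filter fun b : A => τ b ∈ X).image fun b => b + c₀ := by
    ext a
    simp only [mem_filter, mem_univ, true_and, mem_image, Finset.mem_map_equiv, Equiv.mulLeft_symm_apply]
    rw [inv_tau hρρ hττ, hτρ, zero_sub]
    constructor
    · intro h
      exact ⟨-c₀ + a, h, by abel⟩
    · rintro ⟨b, hb, rfl⟩
      have e : -c₀ + (b + c₀) = b := by abel
      rwa [e]
  rw [hset, card_image_of_injective _ (add_left_injective c₀)]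

omit [DecidableEq A] in
/-- Left translation by `τ 0` turns the `τ`-part of `X` into the `ρ`-part. [folklore] -/
theorem card_tau_part_mulLeft_tau (hρρ : ∀ a b, ρ a * ρ b = ρ (a + b)) (hρτ : ∀ a b, ρ a * τ b = τ (b - a))
    (hτρ : ∀ a b, τ a * ρ b = τ (a + b)) (hττ : ∀ a b, τ a * τ b = ρ (c₀ + b - a))
    (hτ : Function.Injective τ) (X : Finset G) :
    (univ.filter fun a : A => τ a ∈ X.map (Equiv.mulLeft (τ 0)).toEmbedding).card =
      (univ.filter fun a : A => ρ a ∈ X).card := by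
  have h2c : c₀ + c₀ = 0 := two_c0_eq_zero hρτ hτρ hττ hτ
  congr 1
  ext a
  simp only [mem_filter, mem_univ, true_and, Finset.mem_map_equiv, Equiv.mulLeft_symm_apply]
  rw [inv_tau hρρ hττ, hττ]
  have e : c₀ + a - (0 - c₀) = a := by
    have : c₀ + a - (0 - c₀) = a + (c₀ + c₀) := by abel
    rw [this, h2c, add_zero]
  rw [e]

/-- Mirrored orientation of `two_cosets_of_shapeB_tpp`: parts `(c+1, c | 2, 2 | 1, 1)`. [folklore] -/
theorem two_cosets_of_shapeB_tpp'
    (hρρ : ∀ a b, ρ a * ρ b = ρ (a + b)) (hρτ : ∀ a b, ρ a * τ b = τ (b - a))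
    (hτρ : ∀ a b, τ a * ρ b = τ (a + b)) (hττ : ∀ a b, τ a * τ b = ρ (c₀ + b - a))
    (hρ : Function.Injective ρ) (hτ : Function.Injective τ) (hne : ∀ a b, ρ a ≠ τ b)
    (hsurj : ∀ g, (∃ a, ρ a = g) ∨ (∃ a, τ a = g)) (h : TripleProductProperty S T U)
    (hS : (univ.filter fun a : A => ρ a ∈ S).card = (univ.filter fun a : A => τ a ∈ S).card + 1)
    (hT₀ : (univ.filter fun a : A => ρ a ∈ T).card = 2) (hT₁ : (univ.filter fun a : A => τ a ∈ T).card = 2)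
    (hU₀ : (univ.filter fun a : A => ρ a ∈ U).card = 1) (hU₁ : (univ.filter fun a : A => τ a ∈ U).card = 1)
    (hV : 3 * (S.card * T.card * U.card) + 8 = 8 * Fintype.card A) :
    ∃ g a b : A, ∀ x : A, x - a ∈ AddSubgroup.zmultiples g ∨ x - b ∈ AddSubgroup.zmultiples g := by
  have h' := tpp_map_mulLeft h (τ 0)
  have rS := card_rho_part_mulLeft_tau hρρ hτρ hττ (c₀ := c₀) S
  have tS := card_tau_part_mulLeft_tau hρρ hρτ hτρ hττ hτ S
  have rT := card_rho_part_mulLeft_tau hρρ hτρ hττ (c₀ := c₀) T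
  have tT := card_tau_part_mulLeft_tau hρρ hρτ hτρ hττ hτ T
  have rU := card_rho_part_mulLeft_tau hρρ hτρ hττ (c₀ := c₀) U
  have tU := card_tau_part_mulLeft_tau hρρ hρτ hτρ hττ hτ U
  refine two_cosets_of_shapeB_tpp hρρ hρτ hτρ hττ hρ hτ hne hsurj h' ?_ ?_ ?_ ?_ ?_ ?_
  · rw [tS, rS, hS]
  · rw [rT, hT₁]
  · rw [tT, hT₀]
  · rw [rU, hU₁]
  · rw [tU, hU₀]
  · simpa only [card_map] using hV

/-- Both orientations of shape `(c, c±1 | 2, 2 | 1, 1)`. [folklore] -/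
theorem two_cosets_of_shapeB_tpp_or
    (hρρ : ∀ a b, ρ a * ρ b = ρ (a + b)) (hρτ : ∀ a b, ρ a * τ b = τ (b - a))
    (hτρ : ∀ a b, τ a * ρ b = τ (a + b)) (hττ : ∀ a b, τ a * τ b = ρ (c₀ + b - a))
    (hρ : Function.Injective ρ) (hτ : Function.Injective τ) (hne : ∀ a b, ρ a ≠ τ b)
    (hsurj : ∀ g, (∃ a, ρ a = g) ∨ (∃ a, τ a = g)) (h : TripleProductProperty S T U)
    (hS : (univ.filter fun a : A => τ a ∈ S).card = (univ.filter fun a : A => ρ a ∈ S).card + 1 ∨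
      (univ.filter fun a : A => ρ a ∈ S).card = (univ.filter fun a : A => τ a ∈ S).card + 1)
    (hT₀ : (univ.filter fun a : A => ρ a ∈ T).card = 2) (hT₁ : (univ.filter fun a : A => τ a ∈ T).card = 2)
    (hU₀ : (univ.filter fun a : A => ρ a ∈ U).card = 1) (hU₁ : (univ.filter fun a : A => τ a ∈ U).card = 1)
    (hV : 3 * (S.card * T.card * U.card) + 8 = 8 * Fintype.card A) :
    ∃ g a b : A, ∀ x : A, x - a ∈ AddSubgroup.zmultiples g ∨ x - b ∈ AddSubgroup.zmultiples g := by
  rcases hS with hS | hS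
  · exact two_cosets_of_shapeB_tpp hρρ hρτ hτρ hττ hρ hτ hne hsurj h hS hT₀ hT₁ hU₀ hU₁ hV
  · exact two_cosets_of_shapeB_tpp' hρρ hρτ hτρ hττ hρ hτ hne hsurj h hS hT₀ hT₁ hU₀ hU₁ hV

/-- **`|A| ≡ 1 (mod 3)`, `|A| ≥ 14`: a law-attaining TPP triple whose coset parts are not a cube forces `A` to be
the union of two cosets of a cyclic subgroup.** [folklore] -/
theorem two_cosets_of_mod_one_law_of_not_cube
    (hρρ : ∀ a b, ρ a * ρ b = ρ (a + b)) (hρτ : ∀ a b, ρ a * τ b = τ (b - a))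
    (hτρ : ∀ a b, τ a * ρ b = τ (a + b)) (hττ : ∀ a b, τ a * τ b = ρ (c₀ + b - a))
    (hρ : Function.Injective ρ) (hτ : Function.Injective τ) (hne : ∀ a b, ρ a ≠ τ b)
    (hsurj : ∀ g, (∃ a, ρ a = g) ∨ (∃ a, τ a = g)) (hmod : Fintype.card A % 3 = 1) (hA : 14 ≤ Fintype.card A)
    (h : TripleProductProperty S T U) (hV : 3 * (S.card * T.card * U.card) + 8 = 8 * Fintype.card A)
    (hnc : ¬ ((univ.filter fun a : A => ρ a ∈ S).card = (univ.filter fun a : A => τ a ∈ S).card ∧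
      (univ.filter fun a : A => ρ a ∈ T).card = (univ.filter fun a : A => τ a ∈ T).card ∧
      (univ.filter fun a : A => ρ a ∈ U).card = (univ.filter fun a : A => τ a ∈ U).card)) :
    ∃ g a b : A, ∀ x : A, x - a ∈ AddSubgroup.zmultiples g ∨ x - b ∈ AddSubgroup.zmultiples g := by
  have hshape := mod_one_law_shape hρρ hρτ hτρ hττ hρ hτ hne hsurj hA h hV
  have cS := card_eq_parts' hρ hτ hne hsurj S
  have cT := card_eq_parts' hρ hτ hne hsurj T
  have cU := card_eq_parts' hρ hτ hne hsurj U
  set s₀ := (univ.filter fun a : A => ρ a ∈ S).card with hs₀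
  set s₁ := (univ.filter fun a : A => τ a ∈ S).card with hs₁
  set t₀ := (univ.filter fun a : A => ρ a ∈ T).card with ht₀
  set t₁ := (univ.filter fun a : A => τ a ∈ T).card with ht₁
  set u₀ := (univ.filter fun a : A => ρ a ∈ U).card with hu₀
  set u₁ := (univ.filter fun a : A => τ a ∈ U).card with hu₁
  have hA7 : 7 ≤ Fintype.card A := by omega
  -- the law in the six role orders
  have hV_TUS : 3 * (T.card * U.card * S.card) + 8 = 8 * Fintype.card A := by
    rw [show T.card * U.card * S.card = S.card * T.card * U.card by ring]; exact hV
  have hV_UST : 3 * (U.card * S.card * T.card) + 8 = 8 * Fintype.card A := by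
    rw [show U.card * S.card * T.card = S.card * T.card * U.card by ring]; exact hV
  have hV_SUT : 3 * (S.card * U.card * T.card) + 8 = 8 * Fintype.card A := by
    rw [show S.card * U.card * T.card = S.card * T.card * U.card by ring]; exact hV
  have hV_TSU : 3 * (T.card * S.card * U.card) + 8 = 8 * Fintype.card A := by
    rw [show T.card * S.card * U.card = S.card * T.card * U.card by ring]; exact hV
  have hV_UTS : 3 * (U.card * T.card * S.card) + 8 = 8 * Fintype.card A := by
    rw [show U.card * T.card * S.card = S.card * T.card * U.card by ring]; exact hV
  -- the rotated / reversed triples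
  have hTUS : TripleProductProperty T U S := h.rotate
  have hUST : TripleProductProperty U S T := h.rotate.rotate
  have hSUT : TripleProductProperty S U T := tpp_reverse h.rotate
  have hTSU : TripleProductProperty T S U := tpp_reverse h.rotate.rotate
  have hUTS : TripleProductProperty U T S := tpp_reverse h
  rcases hshape with ⟨e1, e2, e3⟩ | ⟨et, eu, hcase⟩ | ⟨es, eu, hcase⟩ | ⟨es, et, hcase⟩
  · exact absurd ⟨e1, e2, e3⟩ hnc
  · -- `S` unbalanced, `T`, `U` balanced
    rcases hcase with ⟨hp, hs⟩ | ⟨hp, hs⟩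
    · -- `t₀ u₀ = 1`: `|T| = |U| = 2`, roles `(T, U, S)`
      have ht : t₀ = 1 := Nat.eq_one_of_mul_eq_one_right hp
      have hu : u₀ = 1 := Nat.eq_one_of_mul_eq_one_left hp
      exact two_cosets_of_two_two_law hρρ hρτ hτρ hττ hρ hτ hne hsurj hmod hA7 hTUS (by omega) (by omega) hV_TUS
    · -- `t₀ u₀ = 2`
      have htu : (t₀ = 2 ∧ u₀ = 1) ∨ (t₀ = 1 ∧ u₀ = 2) := by
        have h2 : t₀ ∣ 2 := ⟨u₀, hp.symm⟩
        have ht2 : t₀ ≤ 2 := Nat.le_of_dvd (by norm_num) h2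
        interval_cases t₀ <;> omega
      rcases htu with ⟨ht, hu⟩ | ⟨ht, hu⟩
      · exact two_cosets_of_shapeB_tpp_or hρρ hρτ hτρ hττ hρ hτ hne hsurj h (by omega) ht (by omega) hu
          (by omega) hV
      · exact two_cosets_of_shapeB_tpp_or hρρ hρτ hτρ hττ hρ hτ hne hsurj hSUT (by omega) hu (by omega) ht
          (by omega) hV_SUT
  · -- `T` unbalanced
    rcases hcase with ⟨hp, hs⟩ | ⟨hp, hs⟩
    · have hs1 : s₀ = 1 := Nat.eq_one_of_mul_eq_one_right hp
      have hu : u₀ = 1 := Nat.eq_one_of_mul_eq_one_left hp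
      -- `|U| = |S| = 2`: roles `(U, S, T)`
      exact two_cosets_of_two_two_law hρρ hρτ hτρ hττ hρ hτ hne hsurj hmod hA7 hUST (by omega) (by omega) hV_UST
    · have hsu : (s₀ = 2 ∧ u₀ = 1) ∨ (s₀ = 1 ∧ u₀ = 2) := by
        have h2 : s₀ ∣ 2 := ⟨u₀, hp.symm⟩
        have hs2 : s₀ ≤ 2 := Nat.le_of_dvd (by norm_num) h2
        interval_cases s₀ <;> omega
      rcases hsu with ⟨hs2, hu⟩ | ⟨hs2, hu⟩
      · -- roles `(T, S, U)`
        exact two_cosets_of_shapeB_tpp_or hρρ hρτ hτρ hττ hρ hτ hne hsurj hTSU (by omega) hs2 (by omega) hu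
          (by omega) hV_TSU
      · -- roles `(T, U, S)`
        exact two_cosets_of_shapeB_tpp_or hρρ hρτ hτρ hττ hρ hτ hne hsurj hTUS (by omega) hu (by omega) hs2
          (by omega) hV_TUS
  · -- `U` unbalanced
    rcases hcase with ⟨hp, hs⟩ | ⟨hp, hs⟩
    · have hs1 : s₀ = 1 := Nat.eq_one_of_mul_eq_one_right hp
      have ht : t₀ = 1 := Nat.eq_one_of_mul_eq_one_left hp
      exact two_cosets_of_two_two_law hρρ hρτ hτρ hττ hρ hτ hne hsurj hmod hA7 h (by omega) (by omega) hV
    · have hst : (s₀ = 2 ∧ t₀ = 1) ∨ (s₀ = 1 ∧ t₀ = 2) := by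
        have h2 : s₀ ∣ 2 := ⟨t₀, hp.symm⟩
        have hs2 : s₀ ≤ 2 := Nat.le_of_dvd (by norm_num) h2
        interval_cases s₀ <;> omega
      rcases hst with ⟨hs2, ht⟩ | ⟨hs2, ht⟩
      · -- roles `(U, S, T)`
        exact two_cosets_of_shapeB_tpp_or hρρ hρτ hτρ hττ hρ hτ hne hsurj hUST (by omega) hs2 (by omega) ht
          (by omega) hV_UST
      · -- roles `(U, T, S)`
        exact two_cosets_of_shapeB_tpp_or hρρ hρτ hτρ hττ hρ hτ hne hsurj hUTS (by omega) ht (by omega) hs2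
          (by omega) hV_UTS

/-- **Prime case.** If `|A| = 3p + 1 ≥ 14` with `p` prime, every TPP triple of a dihedral-like group over `A`
attaining the law `3|S||T||U| + 8 = 8|A|` forces `A = (a + ⟨g⟩) ∪ (b + ⟨g⟩)`: `A` has a cyclic subgroup of
index `≤ 2`. [folklore] -/
theorem two_cosets_of_mod_one_law_prime {p : ℕ} (hp : p.Prime)
    (hρρ : ∀ a b, ρ a * ρ b = ρ (a + b)) (hρτ : ∀ a b, ρ a * τ b = τ (b - a))
    (hτρ : ∀ a b, τ a * ρ b = τ (a + b)) (hττ : ∀ a b, τ a * τ b = ρ (c₀ + b - a))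
    (hρ : Function.Injective ρ) (hτ : Function.Injective τ) (hne : ∀ a b, ρ a ≠ τ b)
    (hsurj : ∀ g, (∃ a, ρ a = g) ∨ (∃ a, τ a = g)) (hAp : Fintype.card A = 3 * p + 1) (hA : 14 ≤ Fintype.card A)
    (h : TripleProductProperty S T U) (hV : 3 * (S.card * T.card * U.card) + 8 = 8 * Fintype.card A) :
    ∃ g a b : A, ∀ x : A, x - a ∈ AddSubgroup.zmultiples g ∨ x - b ∈ AddSubgroup.zmultiples g := by
  have hmod : Fintype.card A % 3 = 1 := by rw [hAp]; omega
  by_cases hnc : ((univ.filter fun a : A => ρ a ∈ S).card = (univ.filter fun a : A => τ a ∈ S).card ∧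
      (univ.filter fun a : A => ρ a ∈ T).card = (univ.filter fun a : A => τ a ∈ T).card ∧
      (univ.filter fun a : A => ρ a ∈ U).card = (univ.filter fun a : A => τ a ∈ U).card)
  swap
  · exact two_cosets_of_mod_one_law_of_not_cube hρρ hρτ hτρ hττ hρ hτ hne hsurj hmod hA h hV hnc
  -- the cube `(c,c | d,d | e,e)` with `cde = p`: one of `c, d, e` is `p`, the others are `1`
  obtain ⟨es, et, eu⟩ := hnc
  have cS := card_eq_parts' hρ hτ hne hsurj S
  have cT := card_eq_parts' hρ hτ hne hsurj T
  have cU := card_eq_parts' hρ hτ hne hsurj U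
  set c := (univ.filter fun a : A => ρ a ∈ S).card with hc
  set d := (univ.filter fun a : A => ρ a ∈ T).card with hd
  set e := (univ.filter fun a : A => ρ a ∈ U).card with he
  rw [← es] at cS; rw [← et] at cT; rw [← eu] at cU
  have hcde : c * d * e = p := by
    rw [cS, cT, cU, hAp] at hV
    have : 3 * ((c + c) * (d + d) * (e + e)) = 24 * (c * d * e) := by ring
    omega
  have hA7 : 7 ≤ Fintype.card A := by omega
  have hV_TUS : 3 * (T.card * U.card * S.card) + 8 = 8 * Fintype.card A := by
    rw [show T.card * U.card * S.card = S.card * T.card * U.card by ring]; exact hV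
  have hV_SUT : 3 * (S.card * U.card * T.card) + 8 = 8 * Fintype.card A := by
    rw [show S.card * U.card * T.card = S.card * T.card * U.card by ring]; exact hV
  -- `c ∣ p`
  rcases hp.eq_one_or_self_of_dvd c ⟨d * e, by rw [← hcde]; ring⟩ with hc1 | hcp
  · -- `c = 1`; then `d e = p`
    have hde : d * e = p := by rw [← hcde, hc1, one_mul]
    rcases hp.eq_one_or_self_of_dvd d ⟨e, hde.symm⟩ with hd1 | hdp
    · -- `c = d = 1`: `|S| = |T| = 2`
      exact two_cosets_of_two_two_law hρρ hρτ hτρ hττ hρ hτ hne hsurj hmod hA7 h (by omega) (by omega) hV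
    · -- `d = p`, so `e = 1`: `|S| = |U| = 2`, roles `(S, U, T)`
      have hd0 : 0 < d := by rw [hdp]; exact hp.pos
      have he1 : e = 1 := Nat.eq_of_mul_eq_mul_left hd0 (by rw [mul_one]; exact hde.trans hdp.symm)
      exact two_cosets_of_two_two_law hρρ hρτ hτρ hττ hρ hτ hne hsurj hmod hA7 (tpp_reverse h.rotate) (by omega)
        (by omega) hV_SUT
  · -- `c = p`, so `d = e = 1`: `|T| = |U| = 2`, roles `(T, U, S)`
    have hde : d * e = 1 := by
      have : p * (d * e) = p * 1 := by rw [mul_one, ← mul_assoc, ← hcp, hcde, hcp]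
      exact Nat.eq_of_mul_eq_mul_left hp.pos this
    have hd1 : d = 1 := Nat.eq_one_of_mul_eq_one_right hde
    have he1 : e = 1 := Nat.eq_one_of_mul_eq_one_left hde
    exact two_cosets_of_two_two_law hρρ hρτ hτρ hττ hρ hτ hne hsurj hmod hA7 h.rotate (by omega) (by omega)
      hV_TUS

/-- **No law triple over `A` with small element orders, `|A| = 3p + 1`.**  If `2 · ord(g) < |A|` for every
`g ∈ A` (no cyclic subgroup of index `≤ 2`; e.g. `ℤ₄²`, `ℤ₂² × ℤ₄`, `ℤ₂⁴` at `|A| = 16`, `ℤ₂² × ℤ₁₀` at `|A| = 40`),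
`p` prime, `|A| ≥ 14`, then no TPP triple of a dihedral-like group over `A` attains `3|S||T||U| + 8 = 8|A|`. [folklore] -/
theorem no_mod_one_law_of_small_orders_prime {p : ℕ} (hp : p.Prime)
    (hρρ : ∀ a b, ρ a * ρ b = ρ (a + b)) (hρτ : ∀ a b, ρ a * τ b = τ (b - a))
    (hτρ : ∀ a b, τ a * ρ b = τ (a + b)) (hττ : ∀ a b, τ a * τ b = ρ (c₀ + b - a))
    (hρ : Function.Injective ρ) (hτ : Function.Injective τ) (hne : ∀ a b, ρ a ≠ τ b)
    (hsurj : ∀ g, (∃ a, ρ a = g) ∨ (∃ a, τ a = g)) (hAp : Fintype.card A = 3 * p + 1) (hA : 14 ≤ Fintype.card A)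
    (hord : ∀ g : A, 2 * addOrderOf g < Fintype.card A) (h : TripleProductProperty S T U) :
    3 * (S.card * T.card * U.card) + 8 ≠ 8 * Fintype.card A := by
  intro hV
  obtain ⟨g, a, b, hab⟩ := two_cosets_of_mod_one_law_prime hp hρρ hρτ hτρ hττ hρ hτ hne hsurj hAp hA h hV
  exact absurd (hord g) (not_lt.2 (card_le_two_mul_addOrderOf_of_two_cosets hab))

/-- **Ceiling `law − 2` over such `A`**: with the law gap (`tpp_volume_mod_one_gap`), every TPP triple then has
`3|S||T||U| + 14 ≤ 8|A|`, i.e. `β(G) ≤ (8|A| − 14)/3` — e.g. `β ≤ 38` for every dihedral-like group over an abelian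
group of order `16` and exponent `≤ 4` (census: `β(Dih(ℤ₄²)) = β(Dih(ℤ₂²×ℤ₄)) = 32`), `β ≤ 102` over `ℤ₂² × ℤ₁₀`.
[folklore] -/
theorem tpp_volume_le_law_sub_two_of_small_orders_prime {p : ℕ} (hp : p.Prime)
    (hρρ : ∀ a b, ρ a * ρ b = ρ (a + b)) (hρτ : ∀ a b, ρ a * τ b = τ (b - a))
    (hτρ : ∀ a b, τ a * ρ b = τ (a + b)) (hττ : ∀ a b, τ a * τ b = ρ (c₀ + b - a))
    (hρ : Function.Injective ρ) (hτ : Function.Injective τ) (hne : ∀ a b, ρ a ≠ τ b)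
    (hsurj : ∀ g, (∃ a, ρ a = g) ∨ (∃ a, τ a = g)) (hAp : Fintype.card A = 3 * p + 1) (hA : 14 ≤ Fintype.card A)
    (hord : ∀ g : A, 2 * addOrderOf g < Fintype.card A) (h : TripleProductProperty S T U) :
    3 * (S.card * T.card * U.card) + 14 ≤ 8 * Fintype.card A := by
  have hmod : Fintype.card A % 3 = 1 := by rw [hAp]; omega
  rcases tpp_volume_mod_one_gap hρρ hρτ hτρ hττ hρ hτ hne hsurj hmod hA h with hlaw | hle
  · exact absurd hlaw (no_mod_one_law_of_small_orders_prime hp hρρ hρτ hτρ hττ hρ hτ hne hsurj hAp hA hord h)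
  · exact hle

end DihedralLike

end Summit.MatrixMultiplication.OmegaCensus
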